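import Summits.Ventures.HodgeRepro.Night3WeilModelKP
import Summits.Ventures.HodgeRepro.Night3GSetWeilModel

/-!
# The `G`-set instance of the Weil model (honest form): the exterior cross product `mu`, `κ ∘ μ = id`, the instance
`gsetModelKP`, and «S4 on the CONCRETE Weil spaces of the census faces ⟹ S4 on the concrete Weil space of every
zero-sum corner product»

Blind re-derivation cell `pub-hodge-repro`, seat `night-3` (gen 4).  Imports night-3's `Night3WeilModelKP` (the Weil
model with the Künneth projection `κ` AND the cross product `μ` as fields, `hmul` on `μ`; Lemma P as theorems) and
`Night3GSetWeilModel` (the concrete data `H`, `κ`, `ℓ`, `weilSpace`, the theorems `hW` / `hℓ`).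
Namespace `HodgeRepro.Night3.GSetModel`.

* `mu n k : Hn G n ⊗[ℂ] Hn G k →ₗ[ℂ] Hn G (n + k)` — the cross product on the wedge bases,
  `e_{S₁} ⊗ e_{S₂} ↦ e_{inl S₁ ⊔ inr S₂}`; **`coe_mu_tmul`**: in the exterior algebra `mu (x ⊗ y) = (map inlMap x) * (map inrMap y)` —
  `mu` IS the exterior cross product `x ⊗ y ↦ pr_1^* x ∧ pr_2^* y` (`coe_wedgeBasis_blocksUnionPC`, bilinearity);
  **`kun_mu`**: `kun ∘ mu = id` — the Künneth projection inverts the cross product on the `(n, k)`-component;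
  `mu_line`: `mu (ℓ_σ(n) ⊗ ℓ_σ(k)) = ℓ_σ(n + k)` (the line of the product is the product of the lines);
* `μ M N := cast ∘ mu |M| |N|` and the field `hμℓ` as a theorem;
* **`gsetModelKP Alg Q hmul hproj hQ : WeilModelKP ℂ ℂ G (Multiset (Finset G))`** — the honest instance: `hW`, `hℓ`,
  `hμℓ` theorems; `hmul` in the form `(Alg M ⊗ Alg N).map μ ≤ Alg (M + N)` (products of pull-backs of algebraic classes
  are algebraic — Fulton Ch. 19 / Voisin I Thm 11.38), `hproj` (the correspondence `pr_*((·) ∪ pr^*(y ∪ Λ))`, only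
  the `(n, k)`-summand surviving by degree — the contraction after the projection `κ`), `hQ` (for `N ≠ 0` every line
  pairs non-trivially with some line under `Q_N`) the hypotheses;
* `weilSpace_add_le_alg_kp` / `weilSpace_le_alg_of_add_kp` (Lemma P on the concrete model) and
  **`weilSpace_le_alg_of_faces_kp`** (the suffix `_kp` = «projection and product»; the unsuffixed names of
  `Night3GSetWeilModel` are the superseded comap-form versions): S4 on the concrete Weil spaces of the census faces + Lefschetz (1,1) on the pairs +
  `hmul` / `hproj` / `hQ` ⟹ the concrete Weil space of every zero-sum multiset of CM types is algebraic.

This file SUPERSEDES the withdrawn p381308 (erratum INBOX L6047): there the instance used gen 2's `WeilModel`, whose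
`hmul` in comap-`κ` form is overstrong for a projection `κ`.  What is NOT modelled: `Alg` and `Q` (S4 IS the statement
`weilSpace M ≤ Alg M`), the cup product in general, the cycle map, the `ℚ`-structure (`K = L = ℂ`).  Nothing here
closes S4: `hface` stays a hypothesis; no sealed file is touched; no Tier-2 item depends on this file.
-/

set_option autoImplicit false

open Finset Module TensorProduct
open scoped Pointwise

namespace HodgeRepro.Night3.GSetModel

open HodgeRepro.CMHodgeOn

section Cross

variable {G : Type*} [Fintype G] [DecidableEq G] [LinearOrder G]

/-- **The cross product on the wedge bases**: `e_{S₁} ⊗ e_{S₂} ↦ e_{inl S₁ ⊔ inr S₂}`. -/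
noncomputable def mu (n k : ℕ) : Hn G n ⊗[ℂ] Hn G k →ₗ[ℂ] Hn G (n + k) :=
  ((wedgeBasis n).tensorProduct (wedgeBasis k)).constr ℂ fun p => wedgeBasis (n + k) (blocksUnionPC n k p.1 p.2)

/-- `mu` on a pair of basis vectors. -/
theorem mu_tmul_wedgeBasis (n k : ℕ) (S₁ : Set.powersetCard (Lex (Fin n × G)) n)
    (S₂ : Set.powersetCard (Lex (Fin k × G)) k) :
    mu n k (wedgeBasis n S₁ ⊗ₜ[ℂ] wedgeBasis k S₂) = wedgeBasis (n + k) (blocksUnionPC n k S₁ S₂) := by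
  have h : wedgeBasis n S₁ ⊗ₜ[ℂ] wedgeBasis k S₂ = ((wedgeBasis n).tensorProduct (wedgeBasis k)) (S₁, S₂) := by
    rw [Basis.tensorProduct_apply]
  rw [h]
  exact Basis.constr_basis ((wedgeBasis n).tensorProduct (wedgeBasis k)) ℂ
    (fun p => wedgeBasis (n + k) (blocksUnionPC n k p.1 p.2)) (S₁, S₂)

/-- **`κ ∘ μ = id`**: the Künneth component projection inverts the cross product. -/
theorem kun_mu (n k : ℕ) (x : Hn G n ⊗[ℂ] Hn G k) : kun n k (mu n k x) = x := by
  have : kun (G := G) n k ∘ₗ mu (G := G) n k = LinearMap.id := by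
    refine Basis.ext ((wedgeBasis (G := G) n).tensorProduct (wedgeBasis (G := G) k)) fun p => ?_
    obtain ⟨S₁, S₂⟩ := p
    rw [LinearMap.comp_apply, Basis.tensorProduct_apply, mu_tmul_wedgeBasis, kun_wedgeBasis_blocksUnion,
      LinearMap.id_apply]
  exact LinearMap.congr_fun this x

omit [Fintype G] [LinearOrder G] in
/-- The exterior cross product as a bilinear map into the exterior algebra: `(x, y) ↦ (map inlMap x) * (map inrMap y)`. -/
noncomputable def crossBil (n k : ℕ) : Hn G n →ₗ[ℂ] Hn G k →ₗ[ℂ] ExteriorAlgebra ℂ (V G (n + k)) :=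
  (LinearMap.mul ℂ (ExteriorAlgebra ℂ (V G (n + k)))).compl₁₂
    ((ExteriorAlgebra.map (inlMap n k)).toLinearMap ∘ₗ (⋀[ℂ]^n (V G n)).subtype)
    ((ExteriorAlgebra.map (inrMap n k)).toLinearMap ∘ₗ (⋀[ℂ]^k (V G k)).subtype)

omit [Fintype G] [DecidableEq G] [LinearOrder G] in
/-- `crossBil` on two vectors. -/
theorem crossBil_apply (n k : ℕ) (x : Hn G n) (y : Hn G k) :
    crossBil n k x y = ExteriorAlgebra.map (inlMap n k) (x : ExteriorAlgebra ℂ (V G n)) *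
      ExteriorAlgebra.map (inrMap n k) (y : ExteriorAlgebra ℂ (V G k)) := rfl

/-- **`mu` IS the exterior cross product**: in the exterior algebra, `mu (x ⊗ y) = (map inlMap x) * (map inrMap y)`
(`coe_wedgeBasis_blocksUnionPC` on the bases, then bilinearity). -/
theorem coe_mu_tmul (n k : ℕ) (x : Hn G n) (y : Hn G k) :
    (mu n k (x ⊗ₜ[ℂ] y) : ExteriorAlgebra ℂ (V G (n + k))) =
      ExteriorAlgebra.map (inlMap n k) (x : ExteriorAlgebra ℂ (V G n)) *
        ExteriorAlgebra.map (inrMap n k) (y : ExteriorAlgebra ℂ (V G k)) := by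
  have h : (⋀[ℂ]^(n + k) (V G (n + k))).subtype ∘ₗ mu n k = TensorProduct.lift (crossBil n k) := by
    refine Basis.ext ((wedgeBasis (G := G) n).tensorProduct (wedgeBasis (G := G) k)) fun p => ?_
    obtain ⟨S₁, S₂⟩ := p
    rw [LinearMap.comp_apply, Basis.tensorProduct_apply, mu_tmul_wedgeBasis, TensorProduct.lift.tmul,
      crossBil_apply, Submodule.subtype_apply, coe_wedgeBasis_blocksUnionPC]
  have := LinearMap.congr_fun h (x ⊗ₜ[ℂ] y)
  rw [LinearMap.comp_apply, TensorProduct.lift.tmul, crossBil_apply, Submodule.subtype_apply] at this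
  exact this

/-- **The line of the product is the cross product of the lines**: `mu (ℓ_σ(n) ⊗ ℓ_σ(k)) = ℓ_σ(n + k)`. -/
theorem mu_line (n k : ℕ) (σ : G) : mu n k (line n σ ⊗ₜ[ℂ] line k σ) = line (n + k) σ := by
  rw [← wedgeBasis_lineSet, ← wedgeBasis_lineSet, ← wedgeBasis_lineSet, mu_tmul_wedgeBasis, lineSet_add]

end Cross

section Model

variable {G : Type*} [Fintype G] [DecidableEq G] [LinearOrder G]

/-- **The cross product of the model**: `H M ⊗ H N → H (M + N)`, `mu` after the identification `|M| + |N| = |M + N|`. -/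
noncomputable def μ (M N : Multiset (Finset G)) : H M ⊗[ℂ] H N →ₗ[ℂ] H (M + N) :=
  (castH (Multiset.card_add M N).symm).toLinearMap ∘ₗ mu (Multiset.card M) (Multiset.card N)

/-- `μ` carries the tensor of the `σ`-lines to the `σ`-line of `M + N`. -/
theorem μ_line (M N : Multiset (Finset G)) (σ : G) :
    μ M N (line (Multiset.card M) σ ⊗ₜ[ℂ] line (Multiset.card N) σ) = line (Multiset.card (M + N)) σ := by
  rw [μ, LinearMap.comp_apply, LinearEquiv.coe_coe, mu_line, castH_line]

/-- **`κ ∘ μ = id` on the model.** -/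
theorem κ_μ (M N : Multiset (Finset G)) (x : H M ⊗[ℂ] H N) : κ M N (μ M N x) = x := by
  rw [κ, μ, LinearMap.comp_apply, LinearMap.comp_apply, LinearEquiv.coe_coe, LinearEquiv.coe_coe,
    castH_castH_symm, kun_mu]

/-- **The field `hμℓ`, as a theorem**: `μ ⊗ ℂ (ℓ M σ ⊗ ℓ N σ) = ℓ (M + N) σ` under `distribBaseChange`. -/
theorem hμℓ (M N : Multiset (Finset G)) (σ : G) :
    (μ M N).baseChange ℂ ((AlgebraTensorModule.distribBaseChange ℂ ℂ (H M) (H N)).symm (ℓ M σ ⊗ₜ[ℂ] ℓ N σ)) =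
      ℓ (M + N) σ := by
  simp only [ℓ]
  rw [AlgebraTensorModule.distribBaseChange_symm_tmul, one_mul, LinearMap.baseChange_tmul, μ_line]

/-- **The `G`-set instance of the Weil model (honest form).**  `H`, `κ`, `μ`, `ℓ`, `W` are the concrete objects
(`hW`, `hℓ`, `hμℓ` theorems); `Alg`, `Q` with `hmul` (products of pull-backs of algebraic classes are algebraic, on
the cross product `μ`), `hproj` (the correspondence `pr_*((·) ∪ pr^*(y ∪ Λ))` maps algebraic to algebraic — the
contraction after the projection `κ`) and `hQ` (for `N ≠ 0` every line pairs non-trivially with some line) are the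
hypotheses. -/
noncomputable def gsetModelKP (Alg : ∀ M : Multiset (Finset G), Submodule ℂ (H M))
    (Q : ∀ M : Multiset (Finset G), LinearMap.BilinForm ℂ (H M))
    (hmul : ∀ M N, (Submodule.map₂ (TensorProduct.mk ℂ (H M) (H N)) (Alg M) (Alg N)).map (μ M N) ≤ Alg (M + N))
    (hproj : ∀ M N (y : H N), y ∈ Alg N →
      ((Alg (M + N)).map (κ M N)).map (LemmaP.contract ((Q N).flip y)) ≤ Alg M)
    (hQ : ∀ N, N ≠ 0 → ∀ σ, ∃ τ, Q N (line (Multiset.card N) σ) (line (Multiset.card N) τ) ≠ 0) :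
    WeilModelKP ℂ ℂ G (Multiset (Finset G)) where
  H := H
  κ := κ
  μ := μ
  ℓ := ℓ
  W := weilSpace
  Alg := Alg
  Q := Q
  hW := hW
  hℓ := hℓ
  hμℓ := hμℓ
  hmul := hmul
  hproj := hproj
  hQ := fun N hN σ => by
    obtain ⟨τ, h⟩ := hQ N hN σ
    refine ⟨τ, ?_⟩
    simp only [ℓ]
    rw [LinearMap.BilinForm.baseChange_tmul, one_mul, smul_eq_mul, mul_one]
    exact h

/-- **Lemma P, step (1), on the concrete model** (`WeilModelKP.alg_add` on `gsetModelKP`). -/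
theorem weilSpace_add_le_alg_kp (Alg : ∀ M : Multiset (Finset G), Submodule ℂ (H M))
    (Q : ∀ M : Multiset (Finset G), LinearMap.BilinForm ℂ (H M))
    (hmul : ∀ M N, (Submodule.map₂ (TensorProduct.mk ℂ (H M) (H N)) (Alg M) (Alg N)).map (μ M N) ≤ Alg (M + N))
    (hproj : ∀ M N (y : H N), y ∈ Alg N →
      ((Alg (M + N)).map (κ M N)).map (LemmaP.contract ((Q N).flip y)) ≤ Alg M)
    (hQ : ∀ N, N ≠ 0 → ∀ σ, ∃ τ, Q N (line (Multiset.card N) σ) (line (Multiset.card N) τ) ≠ 0)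
    (M N : Multiset (Finset G)) (hM : weilSpace M ≤ Alg M) (hN : weilSpace N ≤ Alg N) :
    weilSpace (M + N) ≤ Alg (M + N) :=
  (gsetModelKP Alg Q hmul hproj hQ).alg_add M N hM hN

/-- **Lemma P, steps (2)–(3), on the concrete model** (`WeilModelKP.alg_cancel` on `gsetModelKP`). -/
theorem weilSpace_le_alg_of_add_kp (Alg : ∀ M : Multiset (Finset G), Submodule ℂ (H M))
    (Q : ∀ M : Multiset (Finset G), LinearMap.BilinForm ℂ (H M))
    (hmul : ∀ M N, (Submodule.map₂ (TensorProduct.mk ℂ (H M) (H N)) (Alg M) (Alg N)).map (μ M N) ≤ Alg (M + N))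
    (hproj : ∀ M N (y : H N), y ∈ Alg N →
      ((Alg (M + N)).map (κ M N)).map (LemmaP.contract ((Q N).flip y)) ≤ Alg M)
    (hQ : ∀ N, N ≠ 0 → ∀ σ, ∃ τ, Q N (line (Multiset.card N) σ) (line (Multiset.card N) τ) ≠ 0)
    (M N : Multiset (Finset G)) (hMN : weilSpace (M + N) ≤ Alg (M + N)) (hN : weilSpace N ≤ Alg N) :
    weilSpace M ≤ Alg M :=
  (gsetModelKP Alg Q hmul hproj hQ).alg_cancel M N hMN hN

end Model

section Composition

variable {G : Type*} [Group G] [Fintype G] [DecidableEq G] [LinearOrder G]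

/-- **«S4-faces ⟹ S4» on the concrete `G`-set model (honest form).**  `G` a finite group with a complex conjugation `c`;
`Alg`, `Q` with `hmul` (on the cross product `μ`) / `hproj` / `hQ` the algebraic-cycle hypotheses on the concrete
Künneth maps and lines.  If the concrete Weil spaces of the conjugate pairs are algebraic (Lefschetz (1,1)) and the
concrete Weil spaces of the census faces are algebraic (S4 on the faces — the route's open input), then the concrete
Weil space `weilSpace M` is algebraic for every zero-sum multiset `M` of CM types: S4 for the field.  Lemma L
(typer-2), the closure combinatorics (gen 0), Lemma P's linear algebra (gen 2 / `WeilModelKP`) and the Künneth /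
eigenline bookkeeping (this row) are all in the kernel. -/
theorem weilSpace_le_alg_of_faces_kp {c : G} (hc : IsComplexConj c)
    (Alg : ∀ M : Multiset (Finset G), Submodule ℂ (H M))
    (Q : ∀ M : Multiset (Finset G), LinearMap.BilinForm ℂ (H M))
    (hmul : ∀ M N, (Submodule.map₂ (TensorProduct.mk ℂ (H M) (H N)) (Alg M) (Alg N)).map (μ M N) ≤ Alg (M + N))
    (hproj : ∀ M N (y : H N), y ∈ Alg N →
      ((Alg (M + N)).map (κ M N)).map (LemmaP.contract ((Q N).flip y)) ≤ Alg M)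
    (hQ : ∀ N, N ≠ 0 → ∀ σ, ∃ τ, Q N (line (Multiset.card N) σ) (line (Multiset.card N) τ) ≠ 0)
    (hpair : ∀ Φ, IsCMType c Φ → weilSpace {Φ, c • Φ} ≤ Alg {Φ, c • Φ})
    (hface : ∀ Φ p p', IsCMType c Φ → p' ∉ place c p →
      weilSpace (GSet.faceCornersMul c Φ p p') ≤ Alg (GSet.faceCornersMul c Φ p p'))
    (M : Multiset (Finset G)) (hM : GSet.IsZeroSumG c M) : weilSpace M ≤ Alg M :=
  (gsetModelKP Alg Q hmul hproj hQ).alg_of_faces_gset hc hpair hface M hM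

end Composition

end HodgeRepro.Night3.GSetModel
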